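import Summits.QuantumAdvantage.QuantumAdvantage.Theorems.LinnikCubicClassGroupsDegreeOnePrimesEscapeClassPNTDHSmoothedDecay
import Summits.QuantumAdvantage.QuantumAdvantage.Theorems.LinnikCubicClassGroupsDegreeOnePrimesEscapeClassPNTTheta
import HarnessLib

/-!
# The class prime number theorem with DECAYING error, III: the `θ_C`-form

Topic `Summits/QuantumAdvantage/QuantumAdvantage/Theorems`, cell B2b-1 (linnik-cubic), PART A (gen 32);
helper toward the crux `DegreeOnePrimesEscape` (stmt-QuantumAdvantage-11543) of route
`LinnikCubicClassGroups`.  HONEST FRAMING: the value of this file is a THEOREM (kernel-checked,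
GRH-free) — NOT summit progress (the route still rests on the hypothesis-type target
`PureCubicClassNumberHard`).

`thetaClass_decay`: the decaying-error twin of `thetaClass_dichotomy_dh` (`…ClassPNTDHTheta.lean`), obtained
from `smoothedClassSum_decay` (`…ClassPNTDHSmoothedDecay.lean`) by unsmoothing class by class.  GIVEN the
Deuring–Heilbronn phenomenon for the class group `L`-functions (hypothesis `hDH`, the statement of
`Literature.NumberTheory.LFunctions.NumberField.deuringHeilbronn` verbatim), for the number fields `K` of one degree
`n > 1` obeying the family density bound in `Q`-form, with `𝓓_κ(x) = e^{−κ log x/log Q} + e^{−√(κ log x)}`,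
`Q = |d_K| n^n`, and all `x ≥ Q^{a₂}` and classes `C`:
(A) if no zero of the family lies on the exceptional segment `excRegion c K`:
  `|θ_C(x) − x/h| ≤ A x 𝓓_κ(x)/h`;
(B) if `ρ₁ = β₁` is a zero of `F_{ψ₁}` on the segment (then real, `χ₁ = χ_{ψ₁}` real, `L(β₁, χ₁) = 0`):
  `|θ_C(x) − (x − χ₁(C) x^{β₁}/β₁)/h| ≤ A x 𝓓_κ(x) · min(1, (1 − β₁) log x)/h`.
The unsmoothing error `n h (log x + 1)(8√x + 2x^{1−ν} + 1)` (`abs_theta_sub_smoothedPsiClass_le`) and the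
main-term errors `O(√x + x^{1−ν})` are `≤ const · x e^{−(ν/4) log x} · c₁ Q^{−2}` (`unsmoothing_decay`,
`rpow_one_sub_decay`), below both `x 𝓓_κ` and `x 𝓓_κ (1 − β₁) log x` by Stark's effective bound
`c₁ Q^{−2} ≤ 1 − β₁` (`Residue.one_sub_realZero_ge_condQn_rpow`).  This is [ThornerZaman2019, Thm. 5.1 /
Lemma 2.1] for `L = H_K`, `θ_C`-form, at a fixed degree.

References: J. Thorner, A. Zaman, Algebra Number Theory 13 (2019), Thm. 1.4, Lemma 2.1, §5 [ThornerZaman2019];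
A. Weiss, J. reine angew. Math. 338 (1983), Thm. 5.2 [Weiss1983].
-/

noncomputable section

open Complex Real MeasureTheory Set Filter Topology
open scoped NumberField nonZeroDivisors

namespace Summit.QuantumAdvantage.QuantumAdvantage.Theorems.DegreeOnePrimesEscape

open Literature.NumberTheory.LFunctions Literature.NumberTheory.LFunctions.NumberField
  Literature.NumberTheory.LFunctions.EntireEF Literature.NumberTheory.LFunctions.TZWeight
  Literature.NumberTheory.LFunctions.AbelianDensity

set_option maxHeartbeats 1600000 in
/-- **The `θ_C`-form of the class prime number theorem with the Deuring–Heilbronn phenomenon and DECAYING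
error** (see the module docstring). [cite: ThornerZaman2019, Theorem 1.4 and Lemma 2.1] [cite: Weiss1983, Theorem 5.2] -/
theorem thetaClass_decay (n : ℕ) (hn : 1 < n) {b D a : ℝ} (hb : 0 < b) (hD : 0 < D) (ha : 1 ≤ a)
    (hDH : ∃ C : ℝ, 0 < C ∧ ∀ (K : Type) [Field K] [NumberField K] (χ₁ : ClassGroup (𝓞 K) →* ℂˣ),
      χ₁ * χ₁ = 1 → ∀ β₁ : ℝ, 0 < β₁ → β₁ < 1 → classGroupLFunction K χ₁ β₁ = 0 →
      ∀ (χ : ClassGroup (𝓞 K) →* ℂˣ) (ρ : ℂ), classGroupLFunction K χ ρ = 0 → 1 / 2 ≤ ρ.re → ρ ≠ 1 →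
        ρ ≠ β₁ →
        Real.log (1 / (C * (Real.log ((NumberField.discr K).natAbs : ℝ) +
            Module.finrank ℚ K * (Real.log (|ρ.im| + 2) + 1)) * (1 - β₁))) /
          (C * (Real.log ((NumberField.discr K).natAbs : ℝ) +
            Module.finrank ℚ K * (Real.log (|ρ.im| + 2) + 1))) ≤ 1 - ρ.re) :
    ∃ a₂ c κ A : ℝ, 1 ≤ a₂ ∧ 0 < c ∧ c ≤ 1 / (8 * ((n : ℝ) ^ 2 + 1)) ∧ 0 < κ ∧ 0 < A ∧
    ∀ (K : Type) [Field K] [NumberField K], Module.finrank ℚ K = n →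
      (∀ (T : ℝ), 1 ≤ T → ∀ u : AddChar (Additive (ClassGroup (𝓞 K))) ℂ → Finset ℂ,
        (∀ ψ, ∀ ρ ∈ u ψ, famF K ψ ρ = 0 ∧ 1 / 4 ≤ ρ.re ∧ ρ.re < 1 ∧ |ρ.im| ≤ T) →
        ∀ α : ℝ, α ≤ 1 →
          ∑ ψ, ∑ ρ ∈ u ψ with α ≤ ρ.re, (famMult K ψ ρ : ℝ) ≤
            D * Real.exp (b * (a * Real.log (ThornerZaman.condQn K) + Real.log (T + 4))) ^ (1 - α)) →
      ((∀ (ψ : AddChar (Additive (ClassGroup (𝓞 K))) ℂ) (ρ : ℂ), famF K ψ ρ = 0 → 0 < ρ.re →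
          ρ.re < 1 → ¬ excRegion c K ρ) →
        ∀ x : ℝ, ThornerZaman.condQn K ^ a₂ ≤ x → ∀ C : ClassGroup (𝓞 K),
          |chebyshevThetaIdealClass K C x - x / NumberField.classNumber K| ≤
            A * x * (Real.exp (-(κ * Real.log x / Real.log (ThornerZaman.condQn K))) +
              Real.exp (-Real.sqrt (κ * Real.log x))) / NumberField.classNumber K) ∧
      (∀ (ψ₁ : AddChar (Additive (ClassGroup (𝓞 K))) ℂ) (ρ₁ : ℂ), famF K ψ₁ ρ₁ = 0 → 0 < ρ₁.re →
          ρ₁.re < 1 → excRegion c K ρ₁ →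
        ρ₁ = ((ρ₁.re : ℝ) : ℂ) ∧ (toMulHom ψ₁).toHomUnits * (toMulHom ψ₁).toHomUnits = 1 ∧
        classGroupLFunction K (toMulHom ψ₁).toHomUnits ρ₁.re = 0 ∧
        ∀ x : ℝ, ThornerZaman.condQn K ^ a₂ ≤ x → ∀ C : ClassGroup (𝓞 K),
          |chebyshevThetaIdealClass K C x -
              (x - (((toMulHom ψ₁).toHomUnits C : ℂ)).re * x ^ ρ₁.re / ρ₁.re) / NumberField.classNumber K| ≤
            A * x * (Real.exp (-(κ * Real.log x / Real.log (ThornerZaman.condQn K))) +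
              Real.exp (-Real.sqrt (κ * Real.log x))) * min 1 ((1 - ρ₁.re) * Real.log x) /
              NumberField.classNumber K) := by
  classical
  obtain ⟨ν, a₁, c, κ, A, hν0, hν64, ha₁1, hc, hcn, hκ0, hA0, hmain⟩ :=
    smoothedClassSum_decay n hn hb hD ha hDH
  obtain ⟨c₁, hc₁, hc₁1, heff⟩ := Residue.one_sub_realZero_ge_condQn_rpow n hn
  have hn2 : (2 : ℝ) ≤ n := by exact_mod_cast hn
  -- thresholds: unsmoothing and the powers `x^{1-ν}`
  set ΛU : ℝ := (24 + 4 * max 0 (Real.log (88 * ((n : ℝ) + 1) / (ν * c₁)))) / ν with hΛU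
  set ΛP : ℝ := (8 + 4 * max 0 (Real.log (1 / c₁))) / ν with hΛP
  set a₂ : ℝ := max a₁ (max ΛU ΛP) with ha₂
  have ha₂a₁ : a₁ ≤ a₂ := le_max_left _ _
  have ha₂U : ΛU ≤ a₂ := le_trans (le_max_left _ _) (le_max_right _ _)
  have ha₂P : ΛP ≤ a₂ := le_trans (le_max_right _ _) (le_max_right _ _)
  have ha₂1 : 1 ≤ a₂ := le_trans ha₁1 ha₂a₁
  have ha₂8 : 8 ≤ a₂ := by
    refine le_trans ?_ ha₂P
    rw [hΛP, le_div_iff₀ hν0]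
    have : 0 ≤ max 0 (Real.log (1 / c₁)) := le_max_left _ _
    nlinarith
  set κ' : ℝ := min κ (ν / 4) with hκ'
  have hκ'0 : 0 < κ' := lt_min hκ0 (by positivity)
  have hκ'κ : κ' ≤ κ := min_le_left _ _
  have hκ'ν : κ' ≤ ν / 4 := min_le_right _ _
  refine ⟨a₂, c, κ', A + 10, ha₂1, hc, hcn, hκ'0, by positivity, fun K _ _ hKn hdens ↦ ?_⟩
  obtain ⟨hgoodK, hexcK⟩ := hmain K hKn hdens
  have hK : 1 < Module.finrank ℚ K := by rw [hKn]; exact hn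
  set Q : ℝ := ThornerZaman.condQn K with hQ
  have hQ12 : (12 : ℝ) ≤ Q := ThornerZaman.twelve_le_condQn (K := K) hK
  have hQ1 : (1 : ℝ) < Q := by linarith
  have hQ0 : (0 : ℝ) < Q := by linarith
  have hlogQ : 2 ≤ Real.log Q := two_lt_log_twelve.le.trans (Real.log_le_log (by norm_num) hQ12)
  have hlogQ1 : 1 ≤ Real.log Q := by linarith
  have hlogQ0 : 0 < Real.log Q := by linarith
  set h : ℝ := (NumberField.classNumber K : ℝ) with hh
  have hh1 : 1 ≤ h := by rw [hh]; exact_mod_cast one_le_classNumber (K := K)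
  have hh0 : 0 < h := by linarith
  have hhQ : h ≤ Q ^ 4 := by
    have := ThornerZaman.classNumber_le_condQn_pow (K := K) hK; rw [← hQ] at this; exact this
  have hQm2 : Q ^ (-(2 : ℝ)) ≤ 1 := Real.rpow_le_one_of_one_le_of_nonpos hQ1.le (by norm_num)
  have hQm2' : 0 < Q ^ (-(2 : ℝ)) := Real.rpow_pos_of_pos hQ0 _
  set m' : ℝ := c₁ * Q ^ (-(2 : ℝ)) with hm'
  have hm'0 : 0 < m' := mul_pos hc₁ hQm2'
  have hm'1 : m' ≤ 1 := (mul_le_mul hc₁1 hQm2 hQm2'.le zero_le_one).trans (by norm_num)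
  -- common estimates at `x ≥ Q^{a₂}`: the unsmoothing and main-term errors are `≤ 10 x 𝓓_{κ'} m'`
  have hcommon : ∀ x : ℝ, Q ^ a₂ ≤ x → Q ^ a₁ ≤ x ∧ 1 < x ∧
      0 < x ^ (-ν) ∧ x ^ (-ν) ≤ 1 ∧ x ^ (-ν) < Real.log x / 2 ∧ 1 ≤ Real.log x ∧
      (Real.exp (-(κ * Real.log x / Real.log Q)) + Real.exp (-Real.sqrt (κ * Real.log x)) ≤
        Real.exp (-(κ' * Real.log x / Real.log Q)) + Real.exp (-Real.sqrt (κ' * Real.log x))) ∧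
      (∀ C : ClassGroup (𝓞 K), h * |chebyshevThetaIdealClass K C x -
          smoothedPsiClass K C (tzTest (Real.log x) (x ^ (-ν)))| + 9 * x ^ (1 - ν) ≤
        10 * x * (Real.exp (-(κ' * Real.log x / Real.log Q)) + Real.exp (-Real.sqrt (κ' * Real.log x))) * m') ∧
      Real.sqrt x ≤ x ^ (1 - ν) ∧ x ^ (-ν) * x = x ^ (1 - ν) := by
    intro x hx
    have hxa₁ : Q ^ a₁ ≤ x := le_trans (Real.rpow_le_rpow_of_exponent_le hQ1.le ha₂a₁) hx
    have hxQ : Q ≤ x := by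
      have : Q ^ (1 : ℝ) ≤ Q ^ a₂ := Real.rpow_le_rpow_of_exponent_le hQ1.le ha₂1
      rw [Real.rpow_one] at this; linarith
    have hx1 : 1 < x := by linarith
    have hx0 : 0 < x := by linarith
    set L : ℝ := Real.log x with hL
    have hLQ : a₂ * Real.log Q ≤ L := by
      have := Real.log_le_log (by positivity) hx
      rwa [Real.log_rpow (by linarith)] at this
    have hL2 : 16 ≤ L := by nlinarith
    have hL0 : 0 < L := by linarith
    set ε : ℝ := x ^ (-ν) with hε
    have hε0 : 0 < ε := Real.rpow_pos_of_pos hx0 _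
    have hε1 : ε ≤ 1 := Real.rpow_le_one_of_one_le_of_nonpos hx1.le (by linarith)
    have hεL : ε < L / 2 := by linarith
    have hD := decayShape_mono (κ := κ) (κ' := κ') hL0.le hlogQ0 hκ'κ
    -- the decay of `x^{1-ν}` and of the unsmoothing error
    have hP : x ^ (1 - ν) ≤ x * Real.exp (-(ν / 4 * L)) * m' :=
      rpow_one_sub_decay (a := a₂) hQ12 hx hν0 (by linarith) hc₁ (by rw [← hΛP]; exact ha₂P)
    have hU : ∀ C : ClassGroup (𝓞 K), h * |chebyshevThetaIdealClass K C x -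
        smoothedPsiClass K C (tzTest L ε)| ≤ x * Real.exp (-(ν / 4 * L)) * m' := by
      intro C
      have h1 := abs_theta_sub_smoothedPsiClass_le C hx1 hε0 hε1
      rw [hKn] at h1
      have h2 := unsmoothing_decay (n := (n : ℝ)) (h := h) (a := a₂) (Nat.cast_nonneg n) hh0.le hhQ hQ12 hν0
        (by linarith) hc₁ hx (by rw [← hΛU]; exact ha₂U)
      have h3 := mul_le_mul_of_nonneg_left h1 hh0.le
      have e : h * ((n : ℝ) * ((Real.log x + 1) * (8 * Real.sqrt x + 2 * ε * x + 1))) =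
          (n : ℝ) * h * ((Real.log x + 1) * (8 * Real.sqrt x + 2 * x ^ (-ν) * x + 1)) := by rw [hε]; ring
      rw [e] at h3
      exact h3.trans h2
    -- `e^{-(ν/4)L} ≤ 𝓓_{κ'}`
    have hνD : Real.exp (-(ν / 4 * L)) ≤
        Real.exp (-(κ' * L / Real.log Q)) + Real.exp (-Real.sqrt (κ' * L)) :=
      (exp_neg_mul_le_decayShape (by positivity) hL0.le hlogQ1).trans
        (decayShape_mono hL0.le hlogQ0 hκ'ν)
    have hxνD : x * Real.exp (-(ν / 4 * L)) * m' ≤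
        x * (Real.exp (-(κ' * L / Real.log Q)) + Real.exp (-Real.sqrt (κ' * L))) * m' :=
      mul_le_mul_of_nonneg_right (mul_le_mul_of_nonneg_left hνD hx0.le) hm'0.le
    have hsum : ∀ C : ClassGroup (𝓞 K), h * |chebyshevThetaIdealClass K C x -
        smoothedPsiClass K C (tzTest L ε)| + 9 * x ^ (1 - ν) ≤
        10 * x * (Real.exp (-(κ' * L / Real.log Q)) + Real.exp (-Real.sqrt (κ' * L))) * m' := by
      intro C
      have h1 := (hU C).trans hxνD
      have h2 := hP.trans hxνD
      linarith
    have hsqrt : Real.sqrt x ≤ x ^ (1 - ν) := by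
      rw [Real.sqrt_eq_rpow]; exact Real.rpow_le_rpow_of_exponent_le hx1.le (by linarith)
    have hpow : x ^ (-ν) * x = x ^ (1 - ν) := by
      rw [sub_eq_add_neg, Real.rpow_add hx0, Real.rpow_one]; ring
    exact ⟨hxa₁, hx1, hε0, hε1, hεL, by linarith, hD, hsum, hsqrt, hpow⟩
  refine ⟨?_, ?_⟩
  · -- (A) no exceptional zero
    intro hnoexc x hx C
    obtain ⟨hxa₁, hx1, hε0, hε1, hεL, hL1, hD, hU9, hsqrt, hpow⟩ := hcommon x hx
    have hx0 : 0 < x := by linarith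
    set Dκ' : ℝ := Real.exp (-(κ' * Real.log x / Real.log Q)) + Real.exp (-Real.sqrt (κ' * Real.log x))
      with hDκ'
    have hDκ'0 : 0 < Dκ' := by positivity
    have h1 := hgoodK hnoexc x hxa₁ C
    have h1' := (Complex.abs_re_le_norm _).trans h1
    simp only [Complex.sub_re, Complex.mul_re, Complex.natCast_re, Complex.natCast_im,
      Complex.ofReal_re, Complex.ofReal_im, mul_zero, sub_zero] at h1'
    have h2 := abs_re_fordLaplace_tzTest_neg_one_sub_le hx1 hε0 hε1 hεL
    have h3 := hU9 C
    -- `A x 𝓓_κ ≤ A x 𝓓_{κ'}`, `10 x 𝓓 m' ≤ 10 x 𝓓`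
    have hAD : A * x * (Real.exp (-(κ * Real.log x / Real.log Q)) + Real.exp (-Real.sqrt (κ * Real.log x))) ≤
        A * x * Dκ' := mul_le_mul_of_nonneg_left hD (by positivity)
    have h10 : 10 * x * Dκ' * m' ≤ 10 * x * Dκ' := by
      have := mul_le_mul_of_nonneg_left hm'1 (by positivity : (0 : ℝ) ≤ 10 * x * Dκ'); linarith
    have hkey : |h * chebyshevThetaIdealClass K C x - x| ≤ (A + 10) * x * Dκ' := by
      have hDabs : |h * (chebyshevThetaIdealClass K C x -
          smoothedPsiClass K C (tzTest (Real.log x) (x ^ (-ν))))| ≤ 10 * x * Dκ' - 9 * x ^ (1 - ν) := by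
        rw [abs_mul, abs_of_pos hh0]; rw [hDκ'] at h10 ⊢; linarith [h3]
      have hD' := abs_le.1 hDabs
      have hεx : 2 * x ^ (-ν) * x = 2 * x ^ (1 - ν) := by rw [mul_assoc, hpow]
      rw [hεx] at h2
      rw [abs_le] at h1' h2 ⊢
      rw [← hh] at h1'
      rw [hDκ'] at hAD hD' ⊢
      have hP0 : 0 ≤ x ^ (1 - ν) := Real.rpow_nonneg hx0.le (1 - ν)
      constructor <;> linarith [hD'.1, hD'.2, h1'.1, h1'.2, h2.1, h2.2, hsqrt, hAD, hP0]
    have e : chebyshevThetaIdealClass K C x - x / h = (h * chebyshevThetaIdealClass K C x - x) / h := by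
      field_simp
    rw [e, abs_div, abs_of_pos hh0, div_le_div_iff_of_pos_right hh0]
    exact hkey
  · -- (B) the exceptional zero
    intro ψ₁ ρ₁ h0₁ hre₁ hre₁' hexc₁
    obtain ⟨hρ₁, hreal, hexcx⟩ := hexcK ψ₁ ρ₁ h0₁ hre₁ hre₁' hexc₁
    set β₁ : ℝ := ρ₁.re with hβ₁def
    set χ₁ : ClassGroup (𝓞 K) →* ℂˣ := (toMulHom ψ₁).toHomUnits with hχ₁
    have hβ1 : β₁ < 1 := hre₁'
    have hβ1ne : ((β₁ : ℝ) : ℂ) ≠ 1 := by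
      intro h'; apply hβ1.ne; exact_mod_cast h'
    have h0β : famF K ψ₁ (β₁ : ℂ) = 0 := by rw [← hρ₁]; exact h0₁
    have hLzero : classGroupLFunction K χ₁ β₁ = 0 := classGroupLFunction_eq_zero_of_famF ψ₁ h0β hβ1ne
    have hδlow : m' ≤ 1 - β₁ := heff K hKn χ₁ hreal β₁ hβ1 hLzero
    -- `β₁ ≥ 1/2`
    have hβhalf : 1 / 2 ≤ β₁ := by
      have hlog4 : 1 < Real.log 4 := by
        rw [show (4:ℝ) = 2 ^ 2 by norm_num, Real.log_pow]; have := Real.log_two_gt_d9; push_cast; linarith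
      have hlogd : 0 ≤ Real.log ((NumberField.discr K).natAbs : ℝ) := Real.log_natCast_nonneg _
      have hc2 : c ≤ 1 / 2 :=
        hcn.trans (by rw [div_le_div_iff_of_pos_left one_pos (by positivity) (by norm_num)]; nlinarith)
      have : c / (Real.log ((NumberField.discr K).natAbs : ℝ) + Real.log 4) ≤ 1 / 2 := by
        rw [div_le_iff₀ (by linarith)]; nlinarith
      have h' := hexc₁.2
      linarith
    refine ⟨hρ₁, hreal, hLzero, fun x hx C ↦ ?_⟩
    obtain ⟨hxa₁, hx1, hε0, hε1, hεL, hL1, hD, hU9, hsqrt, hpow⟩ := hcommon x hx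
    have hx0 : 0 < x := by linarith
    set Dκ' : ℝ := Real.exp (-(κ' * Real.log x / Real.log Q)) + Real.exp (-Real.sqrt (κ' * Real.log x))
      with hDκ'
    have hDκ'0 : 0 < Dκ' := by positivity
    -- `m' ≤ m = min 1 ((1 - β₁) log x)`
    set m : ℝ := min 1 ((1 - β₁) * Real.log x) with hmdef
    have hδm : 1 - β₁ ≤ (1 - β₁) * Real.log x := by
      have := mul_le_mul_of_nonneg_left hL1 (by linarith : (0 : ℝ) ≤ 1 - β₁); linarith
    have hm'm : m' ≤ m := le_min hm'1 (hδlow.trans hδm)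
    have hm0 : 0 ≤ m := hm'0.le.trans hm'm
    have h1 := hexcx x hxa₁ C
    have h1' := (Complex.abs_re_le_norm _).trans h1
    have hFreal : (fordLaplace (tzTest (Real.log x) (x ^ (-ν))) (-(β₁ : ℂ))).im = 0 := by
      rw [fordLaplace_tzTest_ofReal (Real.log_pos hx1) hε0 β₁, Complex.ofReal_im]
    have hψC : ψ₁ (Additive.ofMul C⁻¹) = (χ₁ C : ℂ) := by
      rw [← classGroupChar_apply_inv_of_real hreal C]
      exact (toHomUnits_toMulHom_apply ψ₁ C⁻¹).symm
    simp only [Complex.add_re, Complex.sub_re, Complex.mul_re, Complex.natCast_re, Complex.natCast_im,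
      Complex.ofReal_re, Complex.ofReal_im, mul_zero, sub_zero, hFreal, hψC] at h1'
    have h2 := abs_re_fordLaplace_tzTest_neg_one_sub_le hx1 hε0 hε1 hεL
    have h4 := abs_re_fordLaplace_tzTest_neg_sub_le hx1 hε0 hε1 hεL hβhalf hβ1.le
    have h3 := hU9 C
    have hχre := abs_re_classGroupChar_apply_le hreal C
    -- scale the error terms from `m'`/`𝓓_κ` to `m`/`𝓓_{κ'}`
    have hAD : A * x * (Real.exp (-(κ * Real.log x / Real.log Q)) +
        Real.exp (-Real.sqrt (κ * Real.log x))) * m ≤ A * x * Dκ' * m :=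
      mul_le_mul_of_nonneg_right (mul_le_mul_of_nonneg_left hD (by positivity)) hm0
    have h10 : 10 * x * Dκ' * m' ≤ 10 * x * Dκ' * m :=
      mul_le_mul_of_nonneg_left hm'm (by positivity)
    set mt : ℝ := x ^ β₁ / β₁ with hmtdef
    have hkey : |h * chebyshevThetaIdealClass K C x - (x - ((χ₁ C : ℂ)).re * mt)| ≤
        (A + 10) * x * Dκ' * m := by
      have hDabs : |h * (chebyshevThetaIdealClass K C x -
          smoothedPsiClass K C (tzTest (Real.log x) (x ^ (-ν))))| ≤ 10 * x * Dκ' * m - 9 * x ^ (1 - ν) := by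
        rw [abs_mul, abs_of_pos hh0]; rw [hDκ'] at h10 ⊢; linarith [h3]
      have hD' := abs_le.1 hDabs
      rw [← hh] at h1'
      set r : ℝ := ((χ₁ C : ℂ)).re with hr
      set Fβ : ℝ := (fordLaplace (tzTest (Real.log x) (x ^ (-ν))) (-(β₁ : ℂ))).re with hFβ
      have hprod : |r * Fβ - r * mt| ≤ 2 * Real.sqrt x + 4 * x ^ (-ν) * x := by
        rw [← mul_sub, abs_mul]
        calc |r| * |Fβ - mt| ≤ 1 * (2 * Real.sqrt x + 4 * x ^ (-ν) * x) :=
              mul_le_mul hχre h4 (abs_nonneg _) zero_le_one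
          _ = _ := one_mul _
      have hε2 : 2 * x ^ (-ν) * x = 2 * x ^ (1 - ν) := by rw [mul_assoc, hpow]
      have hε4 : 4 * x ^ (-ν) * x = 4 * x ^ (1 - ν) := by rw [mul_assoc, hpow]
      rw [hε2] at h2
      rw [hε4] at hprod
      have hprod' := abs_le.1 hprod
      rw [abs_le] at h1' h2 ⊢
      have hmin : min 1 ((1 - ρ₁.re) * Real.log x) = m := by rw [hmdef]
      rw [hmin] at h1'
      rw [hDκ'] at hAD hD' ⊢
      have hP0 : 0 ≤ x ^ (1 - ν) := Real.rpow_nonneg hx0.le (1 - ν)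
      constructor <;> linarith [hD'.1, hD'.2, h1'.1, h1'.2, h2.1, h2.2, hprod'.1, hprod'.2, hsqrt, hAD, hP0]
    rw [hmtdef] at hkey
    have e : chebyshevThetaIdealClass K C x - (x - ((χ₁ C : ℂ)).re * x ^ β₁ / β₁) / h =
        (h * chebyshevThetaIdealClass K C x - (x - ((χ₁ C : ℂ)).re * (x ^ β₁ / β₁))) / h := by
      field_simp
    rw [e, abs_div, abs_of_pos hh0, div_le_div_iff_of_pos_right hh0]
    exact hkey

end Summit.QuantumAdvantage.QuantumAdvantage.Theorems.DegreeOnePrimesEscape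

end
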